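import Mathlib.MeasureTheory.Measure.Count
import Summits.ABC.IUTFork.Cor312EdgeLana
import Summits.ABC.IUTFork.LanaRssBridge
import HarnessLib

/-!
# [IUTchIII] Corollary 3.12 — readings of the edge, III bis: NON-VACUITY of the LANA (9-1) bridge (c312-2, V-c′)

Record-only file (D-0012) of the abc-iut cell; TAKES NO SIDE on [IUTchIII] Cor. 3.12. The cell's rule (README
«RE-CHARTER», LANA Rem. 8.2.1) asks that EVERY fork-level hypothesis carry a non-vacuity witness. `Cor312EdgeLana`
(V-c, p405202) is the one-line bridge «(9-1) at measure level ⟹ the chain's real edges OUTRIGHT»: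
`Cor312Proof.realEdges_of_lanaMainGoal (E) (hq : E.negAbsLogq < 0) (hsub) (h : E.MainGoal) (O)` and its composite
with the typed proof chain `Cor312Proof.cor312_of_chain_of_lanaMainGoal`. The sibling checks of c312-4
(`RssChecks.strictModel` / `exactModel`, counting measure on `Bool`) witness (9-1) itself but NOT these two
theorems: their `q`-regions have log-volume `0`, whereas the bridge (like print, «`|log(q)| > 0`», [IUTchIII]
Cor. 3.12 p. 174) needs `−|log(q)| < 0`. This file supplies the missing witnesses over the two-point space with the
measure `4⁻¹ · count` (volumes `1/4`, `1/2`; log-volumes `−log 4 < −log 2 < 0`):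

* `edgeModel` — `q`-region `{true}`, the one suitable output region IS the `q`-region, hull `= univ`: ALL hypotheses
  of `realEdges_of_lanaMainGoal` / `cor312_of_chain_of_lanaMainGoal` hold together (`edgeModel_hypotheses`), the
  real edges and Cor. 3.12-as-typed follow for EVERY reading `O` of the observations, and the conclusion is
  CONTENTFUL there: `−|log(q)| = −log 4 < −log 2 = −|log(Θ)|` strictly (`edgeModel_strict`).
* `noGoalModel` — `q`-region `univ`, hull = the one suitable region `{true}`: `hq` and `hsub` hold but (9-1) FAILS
  and so does the edge (`noGoalModel_not_realEdges`): in the bridge the hypothesis (9-1) is LOAD-BEARING, not idle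
  (LANA Rem. 8.2.1's test), and the chain hypotheses `hL`/`hC` of the composite are inert (`chain_trivial_reading`:
  the twenty inferences hold at the all-true reading — the composite's content is the bridge's).

Nothing here evaluates (9-1) on IUT data; a toy measure space witnesses satisfiability of typed hypotheses only.
[cite: LANA2026Report, §9.2 (9-1) p. 46, Rem. 8.2.1 p. 42, §10.5 p. 49] [cite: Mochizuki2012, IUTchIII Cor. 3.12 p. 173–174]
-/

noncomputable section

open MeasureTheory

namespace Summit.ABC
namespace IUTFork
namespace Cor312Proof
namespace LanaNV

/-- The measure `4⁻¹ · count` on the two-point space (`{true}` has volume `1/4`, `univ` volume `1/2`). [folklore] -/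
abbrev μq : Measure Bool := (4 : ENNReal)⁻¹ • Measure.count

/-- `4⁻¹ ≠ 0` in `ℝ≥0∞`. [folklore] -/
theorem four_inv_ne_zero : (4 : ENNReal)⁻¹ ≠ 0 := ENNReal.inv_ne_zero.mpr (by norm_num)

/-- `4⁻¹ ≠ ∞` in `ℝ≥0∞`. [folklore] -/
theorem four_inv_ne_top : (4 : ENNReal)⁻¹ ≠ ⊤ := ENNReal.inv_ne_top.mpr (by norm_num)

/-- `μq {true} = 1/4`. [folklore] -/
theorem μq_singleton : μq {true} = (4 : ENNReal)⁻¹ := by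
  rw [Measure.smul_apply, Measure.count_singleton, smul_eq_mul, mul_one]

/-- `μq univ = 1/2`. [folklore] -/
theorem μq_univ : μq Set.univ = (2 : ENNReal)⁻¹ := by
  rw [Measure.smul_apply, Measure.count_apply_finite _ Set.finite_univ, smul_eq_mul]
  have hc : ((Set.finite_univ : (Set.univ : Set Bool).Finite).toFinset.card : ENNReal) = 2 := by simp
  rw [hc]
  have h2 : (2 : ENNReal) ≠ 0 := two_ne_zero
  have h2' : (2 : ENNReal) ≠ ⊤ := ENNReal.ofNat_ne_top
  have h4 : (4 : ENNReal) = 2 * 2 := by norm_num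
  rw [h4, ENNReal.mul_inv (Or.inl h2) (Or.inl h2'), mul_assoc, ENNReal.inv_mul_cancel h2 h2', mul_one]

/-- The region `{true}` (volume `1/4`, log-volume `−log 4`). [folklore] -/
def ptRegion : Region μq where
  carrier := {true}
  measurable := trivial
  vol_ne_zero := by rw [μq_singleton]; exact four_inv_ne_zero
  vol_ne_top := by rw [μq_singleton]; exact four_inv_ne_top

/-- The region `univ` (volume `1/2`, log-volume `−log 2`). [folklore] -/
def allRegion : Region μq where
  carrier := Set.univ
  measurable := trivial
  vol_ne_zero := by rw [μq_univ]; exact ENNReal.inv_ne_zero.mpr (by norm_num)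
  vol_ne_top := by rw [μq_univ]; exact ENNReal.inv_ne_top.mpr (by norm_num)

/-- `log-vol({true}) = −log 4`. [folklore] -/
theorem ptRegion_logVol : ptRegion.logVol = -Real.log 4 := by
  change Real.log (μq {true}).toReal = _
  rw [μq_singleton, ENNReal.toReal_inv, Real.log_inv]
  norm_num

/-- `log-vol(univ) = −log 2`. [folklore] -/
theorem allRegion_logVol : allRegion.logVol = -Real.log 2 := by
  change Real.log (μq Set.univ).toReal = _
  rw [μq_univ, ENNReal.toReal_inv, Real.log_inv]
  norm_num

/-- `−log 4 < 0`. [folklore] -/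
theorem ptRegion_logVol_neg : ptRegion.logVol < 0 := by
  rw [ptRegion_logVol, neg_lt_zero]; exact Real.log_pos (by norm_num)

/-- `−log 2 < 0`. [folklore] -/
theorem allRegion_logVol_neg : allRegion.logVol < 0 := by
  rw [allRegion_logVol, neg_lt_zero]; exact Real.log_pos (by norm_num)

/-- `−log 4 < −log 2`. [folklore] -/
theorem ptRegion_logVol_lt_allRegion_logVol : ptRegion.logVol < allRegion.logVol := by
  rw [ptRegion_logVol, allRegion_logVol, neg_lt_neg_iff]
  exact Real.log_lt_log (by norm_num) (by norm_num)

/-- **The edge model**: `q`-region `{true}` (`−|log(q)| = −log 4 < 0`), the one suitable output region is the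
`q`-region itself (`LGP·S := S`), hull `= univ` (`−|log(Θ)| = −log 2`). [cite: LANA2026Report, §9.2 p. 46] -/
def edgeModel : EtaData μq where
  Rval := volLine 1 one_ne_zero
  qRegion := ptRegion
  LGP S := S
  Suitable := {ptRegion}
  hull := allRegion

/-- `hq`: `−|log(q)| < 0` in the edge model (print's «`|log(q)| > 0`», absent from the counting-measure checks). [folklore] -/
theorem edgeModel_negAbsLogq_neg : edgeModel.negAbsLogq < 0 := ptRegion_logVol_neg

/-- `hsub`: every suitable `LGP·S` lies in the hull. [folklore] -/
theorem edgeModel_suitableInHull : edgeModel.SuitableInHull := fun _ _ => Set.subset_univ _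

/-- (9-1) holds in the edge model (the suitable region IS the `q`-region). [cite: LANA2026Report, §9.2 (9-1) p. 46] -/
theorem edgeModel_mainGoal : edgeModel.MainGoal := ⟨ptRegion, rfl, rfl⟩

/-- **The twenty typed inferences hold at the ALL-TRUE reading** of loci and observations (each `Step.Holds` concludes
observations that are granted): the chain hypotheses `hL`/`hC` of `cor312_of_chain_of_lanaMainGoal` are inert —
recorded so that the composite's non-vacuity below is seen to rest on the bridge alone. [folklore] -/
theorem chain_trivial_reading : Chain (fun _ : Locus => True) (fun _ : Obs => True) :=
  fun _ _ _ _ _ => trivial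

/-- **NON-VACUITY of `realEdges_of_lanaMainGoal`**: its hypotheses `hq`, `hsub`, (9-1) hold TOGETHER on measure-
theoretic data, and then the real edges hold for every reading `O`. [cite: LANA2026Report, Rem. 8.2.1 p. 42] -/
theorem edgeModel_hypotheses :
    ∃ (E : EtaData μq) (hq : E.negAbsLogq < 0),
      (∀ S ∈ E.Suitable, (E.LGP S).carrier ⊆ E.hull.carrier) ∧ E.MainGoal ∧
        ∀ O : Obs → Prop, RealEdges O (Volumes.ofEtaData E hq) :=
  ⟨edgeModel, edgeModel_negAbsLogq_neg, edgeModel_suitableInHull, edgeModel_mainGoal,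
    fun O => realEdges_of_lanaMainGoal edgeModel edgeModel_negAbsLogq_neg edgeModel_suitableInHull edgeModel_mainGoal O⟩

/-- … and of the composite `cor312_of_chain_of_lanaMainGoal`: Cor. 3.12 AS TYPED (`Volumes.Cor312`) for the edge
model's volumes, from loci ∧ chain ∧ (9-1) — every hypothesis discharged. [cite: LANA2026Report, §9 p. 44] -/
theorem edgeModel_cor312 : (Volumes.ofEtaData edgeModel edgeModel_negAbsLogq_neg).Cor312 :=
  cor312_of_chain_of_lanaMainGoal edgeModel edgeModel_negAbsLogq_neg edgeModel_suitableInHull edgeModel_mainGoal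
    (L := fun _ => True) (O := fun _ => True) (fun _ => trivial) chain_trivial_reading

/-- **The conclusion is contentful in the edge model**: `−|log(q)| = −log 4 < −log 2 = −|log(Θ)|` STRICTLY, with
`−|log(q)| < 0` — not the degenerate equality / zero-volume configurations. [folklore] -/
theorem edgeModel_strict :
    edgeModel.negAbsLogq < edgeModel.negAbsLogTheta ∧ edgeModel.negAbsLogq < 0 :=
  ⟨ptRegion_logVol_lt_allRegion_logVol, ptRegion_logVol_neg⟩

/-- **The no-goal model**: `q`-region `univ` (`−|log(q)| = −log 2 < 0`), hull = the one suitable region `{true}`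
(`−|log(Θ)| = −log 4`): `hq` and `hsub` hold, (9-1) fails. [cite: LANA2026Report, Rem. 8.2.1 p. 42] -/
def noGoalModel : EtaData μq where
  Rval := volLine 1 one_ne_zero
  qRegion := allRegion
  LGP S := S
  Suitable := {ptRegion}
  hull := ptRegion

/-- `hq` holds in the no-goal model. [folklore] -/
theorem noGoalModel_negAbsLogq_neg : noGoalModel.negAbsLogq < 0 := allRegion_logVol_neg

/-- `hsub` holds in the no-goal model. [folklore] -/
theorem noGoalModel_suitableInHull : noGoalModel.SuitableInHull := fun S h => by
  obtain rfl : S = ptRegion := Set.mem_singleton_iff.mp h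
  show ptRegion.carrier ⊆ ptRegion.carrier
  exact subset_rfl

/-- (9-1) FAILS in the no-goal model (`vol(univ) = 1/2 ≠ 1/4 = vol({true})`). [folklore] -/
theorem noGoalModel_not_mainGoal : ¬ noGoalModel.MainGoal := by
  rw [EtaData.mainGoal_iff_logVol]
  rintro ⟨S, hS, hvol⟩
  have hS' : S = ptRegion := Set.mem_singleton_iff.mp hS
  subst hS'
  change ptRegion.logVol = allRegion.logVol at hvol
  exact absurd hvol ptRegion_logVol_lt_allRegion_logVol.ne

/-- … and so does the EDGE: `−|log(q)| = −log 2 ≰ −log 4 = −|log(Θ)|` — no real edges for ANY reading `O` that grants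
(xi-f)'s «constitutes a construction» observation; in particular Cor. 3.12-as-typed fails for these volumes.
[cite: LANA2026Report, Rem. 8.2.1 p. 42] -/
theorem noGoalModel_not_realEdges {O : Obs → Prop} (hO : O .constitutesConstruction) :
    ¬ RealEdges O (Volumes.ofEtaData noGoalModel noGoalModel_negAbsLogq_neg) := by
  intro h
  have hle : noGoalModel.negAbsLogq ≤ noGoalModel.negAbsLogTheta :=
    (Volumes.ofEtaData_cor312_iff noGoalModel noGoalModel_negAbsLogq_neg).mp ⟨h.finite, h.inclusion hO⟩
  exact absurd hle (not_le.mpr ptRegion_logVol_lt_allRegion_logVol)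

/-- **(9-1) IS LOAD-BEARING in the bridge** (LANA Rem. 8.2.1's test, at this level of typing): there are measure-
theoretic `η`-data satisfying `hq` and `hsub` at which (9-1) fails and the real edges fail for every reading granting
the (xi-f) observation — so `realEdges_of_lanaMainGoal` does not hold with its hypothesis (9-1) deleted. [cite: LANA2026Report, Rem. 8.2.1 p. 42] -/
theorem mainGoal_loadBearing :
    ∃ (E : EtaData μq) (hq : E.negAbsLogq < 0),
      (∀ S ∈ E.Suitable, (E.LGP S).carrier ⊆ E.hull.carrier) ∧ ¬ E.MainGoal ∧
        ∀ O : Obs → Prop, O .constitutesConstruction → ¬ RealEdges O (Volumes.ofEtaData E hq) :=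
  ⟨noGoalModel, noGoalModel_negAbsLogq_neg, noGoalModel_suitableInHull, noGoalModel_not_mainGoal,
    fun _ hO => noGoalModel_not_realEdges hO⟩

end LanaNV
end Cor312Proof
end IUTFork
end Summit.ABC

end
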